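import Literature.NumberTheory.EllipticCurves.ModularSymbolsControlSurjective
import HarnessLib

/-!
# The uniqueness half of Stevens' control theorem in slope `0` (coefficients `D̂_k`)

Complement to `ModularSymbolsControlSurjective`: in the `F`-completion `D̂_k = lim_N 𝔻⁰_k/F^N`
(`hatDist`), **a `U_p`-eigensymbol with unit eigenvalue whose reduction modulo `F⁰` vanishes (i.e.
whose moments of order `≤ k` vanish) is zero** (`hatSymb_eq_zero_of_hecke_eq_unit_smul`), hence the
lift of `ModularSymbolsControlSurjective.exists_hatEigensymbol` is unique
(`hatEigensymbol_unique`).  Proof: by induction on the level, a class in `𝔻⁰/F^{n+1}` reducing to `0`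
in `𝔻⁰/F^n` is represented by an element of `F^n`, on which `U_p` lands in `F^{n+1}`
(`hecke_val_mem_filGInt_succ`), so `u·(level n+1 component) = 0`.  Together with the existence half
this is Greenberg 2007, Thm. 9 / Stevens' control theorem in slope `0` for the coefficient module
`D̂_k`: **`Φ̂ ↦ Φ̂ mod F⁰` is a bijection between unit-eigenvalue `U_p`-eigensymbols in
`Symb_{Γ₀(N)}(D̂_k)` and their reductions.**

Brick B3e-S3c of the bottom-up plan recorded with the named fact
`greenbergStevens_kitagawa_twoVariable_interpolation_allBranches`.  Everything is proved; no named facts.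

## References

* M. Greenberg, Israel J. Math. 161 (2007), Thm. 9. [Greenberg2007Lifting]
-/

noncomputable section

open scoped MatrixGroups
open Matrix CongruenceSubgroup

namespace Literature.NumberTheory.EllipticCurves

open ModularForms ModularForms.HidaCohomology

variable {p : ℕ} [Fact p.Prime] [NeZero p] (k : ℕ) {N : ℕ} (hpN : p ∣ N) (u : ℤ_[p]ˣ)

omit [NeZero p] in
/-- A class in `𝔻⁰/F^{n+1}` which vanishes in `𝔻⁰/F^n` is represented by an element of `F^n`. [folklore] -/
theorem exists_rep_mem_filGInt {n : ℕ} (c : DInt p ⧸ filGInt p k (n + 1))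
    (hc : CoeffActionOn.transQ (filGInt_antitone (p := p) k) (Nat.le_succ n) c = 0) :
    ∃ v : DInt p, v ∈ filGInt p k n ∧ Submodule.Quotient.mk v = c := by
  induction c using Submodule.Quotient.induction_on with
  | H v =>
    refine ⟨v, ?_, rfl⟩
    rw [CoeffActionOn.transQ_mk] at hc
    exact (Submodule.Quotient.mk_eq_zero _).mp hc

/-- **Uniqueness half of the slope-`0` control theorem**: a `U_p`-eigensymbol `Φ ∈ Symb_{Γ₀(N)}(D̂_k)` with
unit eigenvalue whose level-`0` component (reduction modulo `F⁰`) vanishes is zero. [cite: Greenberg2007Lifting, Thm. 9] -/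
theorem hatSymb_eq_zero_of_hecke_eq_unit_smul (Φ : (hatDist p k N hpN).Symb (Gamma0 N))
    (heig : (hatDist p k N hpN).hecke N p Φ.1 = (u : ℤ_[p]) • Φ.1) (h0 : ∀ x y, (Φ.1 x y).1 0 = 0) : Φ = 0 := by
  have hβ : ∀ i : HeckeIdx N p, heckeRep p i.1 ∈ sigma0Set N := fun i => heckeRep_mem_sigma0Set Fact.out i
  -- all components vanish, by induction on the level
  have hall : ∀ n : ℕ, ∀ x y, (Φ.1 x y).1 n = 0 := by
    intro n
    induction n with
    | zero => exact h0
    | succ n ih =>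
      -- representatives in `F^n`
      have hrep : ∀ x y, ∃ v : DInt p, v ∈ filGInt p k n ∧ Submodule.Quotient.mk v = (Φ.1 x y).1 (n + 1) := fun x y =>
        exists_rep_mem_filGInt k _ (by rw [(Φ.1 x y).2 n (n + 1) (Nat.le_succ n)]; exact ih x y)
      choose v hv hvmk using hrep
      -- the level-`n+1` component of `Φ` is the reduction of `v`
      have hcomp : ((distCoeffInt p k N hpN).projHom (sigma0Set_mulClosed N) (isInvariant_filGInt k N hpN) (filGInt_antitone k)
          (n + 1)).mapFun Φ.1 = (filRedHom k N hpN (n + 1)).mapFun v := by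
        funext x y
        exact (hvmk x y).symm
      -- `U_p v` has values in `F^{n+1}`, so the level-`n+1` component of `U_p Φ` vanishes
      have hproj := (distCoeffInt p k N hpN).projSymb_hecke (sigma0Set_mulClosed N) (isInvariant_filGInt k N hpN)
        (filGInt_antitone k) hβ (n + 1) Φ.1
      intro x y
      have hx := congrFun (congrFun hproj x) y
      rw [hcomp] at hx
      have hh := (filRedHom k N hpN (n + 1)).mapFun_hecke hβ v
      have hx' : _ = ((filRedHom k N hpN (n + 1)).mapFun ((distCoeffInt p k N hpN).hecke N p v)) x y :=
        hx.trans (congrFun (congrFun hh.symm x) y)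
      have hzero : (filRedHom k N hpN (n + 1)).mapFun ((distCoeffInt p k N hpN).hecke N p v) x y = 0 :=
        (Submodule.Quotient.mk_eq_zero _).mpr (hecke_val_mem_filGInt_succ k N hpN n v hv x y)
      rw [hzero] at hx'
      have hx : (((hatDist p k N hpN).hecke N p Φ.1) x y).1 (n + 1) = 0 := hx'
      -- the same component of `u • Φ`
      have hux : (((u : ℤ_[p]) • Φ.1) x y).1 (n + 1) = 0 := by
        rw [← heig]; exact hx
      have hux' : (u : ℤ_[p]) • ((Φ.1 x y).1 (n + 1)) = 0 := hux
      have := congrArg (fun c => ((u⁻¹ : ℤ_[p]ˣ) : ℤ_[p]) • c) hux'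
      simpa only [smul_smul, Units.inv_mul, one_smul, smul_zero] using this
  refine Subtype.ext (funext fun x => funext fun y => Subtype.ext (funext fun n => ?_))
  exact hall n x y

/-- **Uniqueness of the lift**: two unit-eigenvalue `U_p`-eigensymbols in `Symb_{Γ₀(N)}(D̂_k)` with the same
reduction modulo `F⁰` are equal. [cite: Greenberg2007Lifting, Thm. 9] -/
theorem hatEigensymbol_unique (Φ Ψ : (hatDist p k N hpN).Symb (Gamma0 N))
    (hΦ : (hatDist p k N hpN).hecke N p Φ.1 = (u : ℤ_[p]) • Φ.1) (hΨ : (hatDist p k N hpN).hecke N p Ψ.1 = (u : ℤ_[p]) • Ψ.1)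
    (h0 : ∀ x y, (Φ.1 x y).1 0 = (Ψ.1 x y).1 0) : Φ = Ψ := by
  rw [← sub_eq_zero]
  refine hatSymb_eq_zero_of_hecke_eq_unit_smul k hpN u (Φ - Ψ) ?_ fun x y => ?_
  · change (hatDist p k N hpN).hecke N p (Φ.1 - Ψ.1) = (u : ℤ_[p]) • (Φ.1 - Ψ.1)
    rw [map_sub, hΦ, hΨ, smul_sub]
  · change ((Φ.1 - Ψ.1) x y).1 0 = 0
    rw [Pi.sub_apply, Pi.sub_apply]
    change (Φ.1 x y).1 0 - (Ψ.1 x y).1 0 = 0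
    rw [h0, sub_self]

/-! ### The control theorem in slope `0` (existence and uniqueness) -/

/-- **Stevens' control theorem in slope `0`, coefficients `D̂_k` (Greenberg 2007, Thm. 9)**: for an
additive `𝔻⁰_k`-valued `Φ₀` with `ρ_k`-invisible defects there is a UNIQUE unit-eigenvalue
`U_p`-eigensymbol `Φ̂ ∈ Symb_{Γ₀(N)}(D̂_k)` lifting `Φ₀` modulo `F⁰`. [cite: Greenberg2007Lifting, Thm. 9] -/
theorem existsUnique_hatEigensymbol (Φ₀ : P1Q → P1Q → DInt p) (h0 : Φ₀ ∈ modSym ℤ_[p] (DInt p))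
    (hΓ0 : ∀ γ : Gamma0 N, ∀ (x y : P1Q) (i : ℕ), i ≤ k →
      moment (((distCoeffInt p k N hpN).slash (gmat γ) Φ₀ - Φ₀) x y).1 i = 0)
    (hU0 : ∀ (x y : P1Q) (i : ℕ), i ≤ k →
      moment (((distCoeffInt p k N hpN).hecke N p Φ₀ - (u : ℤ_[p]) • Φ₀) x y).1 i = 0) :
    ∃! Φ : (hatDist p k N hpN).Symb (Gamma0 N),
      (hatDist p k N hpN).hecke N p Φ.1 = (u : ℤ_[p]) • Φ.1 ∧ ∀ x y, (Φ.1 x y).1 0 = Submodule.Quotient.mk (Φ₀ x y) := by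
  obtain ⟨Φ, hΦ, hΦ0⟩ := exists_hatEigensymbol k hpN u Φ₀ h0 hΓ0 hU0
  refine ⟨Φ, ⟨hΦ, hΦ0⟩, fun Ψ ⟨hΨ, hΨ0⟩ => hatEigensymbol_unique k hpN u Ψ Φ hΨ hΦ fun x y => by rw [hΨ0, hΦ0]⟩

/-- **The control theorem from an exact eigensymbol.**  Let `π : 𝔻⁰_k → L` be a morphism of coefficient
systems whose kernel is exactly the measures with vanishing moments of order `≤ k` (the specialisation
`ρ_k` to `Symᵏ`), and `φ ∈ Symb_{Γ₀(N)}(L)` an exact `U_p`-eigensymbol with unit eigenvalue whose values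
lie in the range of `π`.  Then `φ` lifts to a unique unit-eigenvalue eigensymbol `Φ̂ ∈ Symb_{Γ₀(N)}(D̂_k)`:
`π̄(Φ̂(x,y) mod F⁰) = φ(x,y)`. [cite: Greenberg2007Lifting, Thm. 9] -/
theorem exists_hatEigensymbol_of_exact {L : Type*} [AddCommGroup L] [Module ℤ_[p] L]
    (B : CoeffActionOn (sigma0Set N) ℤ_[p] L) (π : CoeffActionOn.Hom (distCoeffInt p k N hpN) B)
    (hker : ∀ μ : DInt p, π.toLinearMap μ = 0 → ∀ i ≤ k, moment μ.1 i = 0)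
    (hF0 : filGInt p k 0 ≤ LinearMap.ker π.toLinearMap)
    (φ : B.Symb (Gamma0 N)) (hφ : B.hecke N p φ.1 = (u : ℤ_[p]) • φ.1)
    (hrange : ∀ y, φ.1 P1Q.infty y ∈ LinearMap.range π.toLinearMap) :
    ∃ Φ : (hatDist p k N hpN).Symb (Gamma0 N),
      (hatDist p k N hpN).hecke N p Φ.1 = (u : ℤ_[p]) • Φ.1 ∧
        ∀ x y, (filGInt p k 0).liftQ π.toLinearMap hF0 ((Φ.1 x y).1 0) = φ.1 x y := by
  have hβ : ∀ i : HeckeIdx N p, heckeRep p i.1 ∈ sigma0Set N := fun i => heckeRep_mem_sigma0Set Fact.out i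
  -- an additive lift
  obtain ⟨Φ₀, h0, hlift⟩ := exists_additive_lift π.toLinearMap φ.2.1 hrange
  have hmap : π.mapFun Φ₀ = φ.1 := funext fun x => funext fun y => hlift x y
  -- its defects are `π`-invisible, hence have vanishing low moments
  have hΓ0 : ∀ γ : Gamma0 N, ∀ (x y : P1Q) (i : ℕ), i ≤ k →
      moment (((distCoeffInt p k N hpN).slash (gmat γ) Φ₀ - Φ₀) x y).1 i = 0 := by
    intro γ x y i hi
    refine hker _ ?_ i hi
    have h := congrFun (congrFun (π.mapFun_slash (gamma0_mem_sigma0Set N γ) Φ₀) x) y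
    rw [hmap, φ.2.2 (γ : SL(2, ℤ)) γ.2, CoeffActionOn.Hom.mapFun_apply] at h
    rw [Pi.sub_apply, Pi.sub_apply, map_sub, h, hlift, sub_self]
  have hU0 : ∀ (x y : P1Q) (i : ℕ), i ≤ k →
      moment (((distCoeffInt p k N hpN).hecke N p Φ₀ - (u : ℤ_[p]) • Φ₀) x y).1 i = 0 := by
    intro x y i hi
    refine hker _ ?_ i hi
    have h := congrFun (congrFun (π.mapFun_hecke hβ Φ₀) x) y
    rw [hmap, hφ, CoeffActionOn.Hom.mapFun_apply] at h
    rw [Pi.sub_apply, Pi.sub_apply, map_sub, h]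
    simp only [Pi.smul_apply, map_smul, hlift, sub_self]
  obtain ⟨Φ, hΦ, hΦ0⟩ := exists_hatEigensymbol k hpN u Φ₀ h0 hΓ0 hU0
  refine ⟨Φ, hΦ, fun x y => ?_⟩
  rw [hΦ0, Submodule.liftQ_apply, hlift]

end Literature.NumberTheory.EllipticCurves

end
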